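import Mathlib
import Summits.Ventures.HodgeRepro.CMType
import Summits.Ventures.HodgeRepro.HodgeSets
import Summits.Ventures.HodgeRepro.CMRank
import Summits.Ventures.HodgeRepro.Groups
import Summits.Ventures.HodgeRepro.Primitive
import Summits.Ventures.HodgeRepro.MuTable
import Summits.Ventures.HodgeRepro.MuDecide
import Summits.Ventures.HodgeRepro.MuWeightsTransport
import Summits.Ventures.HodgeRepro.MuPairs
import Summits.Ventures.HodgeRepro.MuPairsRank
import Summits.Ventures.HodgeRepro.MuPairsCensusGen
import Summits.Ventures.HodgeRepro.RankCertZ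
import Summits.Ventures.HodgeRepro.RankCensus6

/-! # The pairs theorem across the census: degree 6 (`C6`) (seat p2; see `MuPairsCensusGen.lean`). -/

set_option autoImplicit false

open Finset
open scoped Pointwise

namespace HodgeRepro

/-! ### Degree 6 -/

/-- Every Hodge set of every CM type of `C6` is a disjoint union of antipodal pairs. -/
theorem isPairUnion_C6 {Φ : Finset C6} (hΦ : IsCMType cc_C6 Φ) {Δ : Finset C6}
    (hΔ : IsHodgeSet cc_C6 Φ Δ) : IsPairUnion Φ Δ :=
  isPairUnion_of_cover cc_C6_isComplexConj reps_C6 ranks_C6 (by decide) cmRank_reps_C6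
    (by decide) (by decide) (fun _ h => isCMType_C6_cover h) hΦ hΔ

end HodgeRepro
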